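import Mathlib
import HarnessLib
import HarnessLib.Audit
import Summits.HodgeConjecture.HodgeConjecture.Theorems.NikulinTwinTransportTwinTwistorTransportReduction
import Summits.HodgeConjecture.HodgeConjecture.Theorems.NikulinTwinTransportTwinTwistorTransportPeriodInvariance
import Summits.HodgeConjecture.HodgeConjecture.Theorems.NikulinTwinTransportTwinTwistorTransportOffWallStable
import Summits.HodgeConjecture.HodgeConjecture.Theorems.NikulinTwinTransportTwinTwistorTransportLocPathConnected
import Summits.HodgeConjecture.HodgeConjecture.Theorems.NikulinTwinTransportTwinTwistorTransportOffWallPolarisation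
import Literature.AlgebraicGeometry.Surfaces.K3CMPeriodLattice
import Literature.AlgebraicGeometry.Surfaces.PolarisedK3TwinKuranishiFamily
import Literature.AlgebraicGeometry.Surfaces.K3HodgeTypesHolds
import Literature.AlgebraicGeometry.Surfaces.K3SurfaceBuskinLeaves
import Literature.AlgebraicGeometry.HodgeTheory.GysinBaseChange

/-!
# Line `reduced-virtual-count-twin-locus` — crux `NikulinTwinTransport.TwinTwistorTransport` (stmt-HodgeConjecture-14393)

LEAD RESHAPE r1 (prover-line-stmt-HodgeConjecture-14393-c1-0, 2026-08-16, cycle 1 of the continuation):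
* `stub_periodInvariance` is LANDED verbatim (`Theorems.NikulinTwinTransport.stub_periodInvariance`,
  p95441) and is no longer a stub: the composition calls the theorem;
* `stub_offWallBall` (walls locally finite + `D_h` locally path-connected) is SPLIT into two
  registered, independent, Mathlib-sized topology stubs `stub_offWallStable` (off-wall is an open
  condition on `D_h`: the `(−2)`/`(−4)`-walls through a neighbourhood of an off-wall point are
  finitely many, none through the point) and `stub_periodDomainLocPathConnected` (`D_h` is locally
  path-connected, quantitatively: nearby points are joined inside `D_h ∩ B(x₀, ε)`); `OffWallBall`
  is DERIVED (`offWallBall_of`);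
* `stub_k3TransferFacts` SHRINKS to the two named Literature facts still unproved:
  `Huybrechts_K3_marking_exists ∧ cupProduct_mem_algebraicClasses_tripleProduct_surfaces` —
  `Huybrechts_K3_hodgeTypes_H2` is now a theorem (`Huybrechts_K3_hodgeTypes_H2_holds`), `CorrComp[]`
  follows from the second fact by the tree's `corrComp_surfaces_of_cup'`, and, per the route-choice
  FACT POLICY (RCHOICE-K3PeriodSurjective, 2026-08-16T09:18Z), period surjectivity is consumed BY NAME
  as the route crux `Theses.NikulinTwinTransport.K3PeriodSurjective` (stmt-HodgeConjecture-15154,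
  definitionally the Literature fact with `IsK3Surface` unfolded) — a hypothesis of the composition
  next to Buskin's `HodgeIsometryAlgebraic`, never a stub;
* `stub_twinSpread` keeps its statement with the same re-wiring of its first antecedent (r1) and gains the
  antecedents `HodgeIsometryAlgebraic → CorrComp[] →` (r2, after the wave-1 worker's analysis);
* `stub_nonzeroReducedClass` (the heart) is unchanged and held by the lead.
Registered stubs after r1: `stub_nonzeroReducedClass`, `stub_offWallStable`,
`stub_periodDomainLocPathConnected`, `stub_twinSpread`, `stub_k3TransferFacts` (5 ≤ 7).
WAVE 1 (2026-08-16 11:32Z–12:35Z): `stub_offWallStable` LANDED p99899 and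
`stub_periodDomainLocPathConnected` LANDED p101842 (both `Theorems.NikulinTwinTransport.*`, imported and
plugged in below); open after r2: `stub_nonzeroReducedClass` (lead), `stub_twinSpread` (XL formal, blocked:
no universal twin family in the tree), `stub_k3TransferFacts` (named facts).
LEAD RESHAPE r3 (same day, after the wave's `stub-blocked` on `stub_twinSpread`: the universal polarised
twin family, relative Hilbert schemes and the algebraicity-locus fact are all ABSENT — a definition gap, not
a proof gap): `TwinSpread` is DROPPED. Instead the heart is stated COMPONENT-WISE (an anchor with non-zero
count joined inside the off-wall locus to any given off-wall period — BKP Thm 1.11 deformation invariance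
pays for this in the informal proof) and the given period is MADE off-wall by choosing the polarisation
vector (`stub_offWallPolarisation`, pure lattice theory on existing carriers, size L). The chain no longer
passes through `OffWallBall`; the lead's tightness theorem `nonzeroReducedClass_iff_crux` and
`offWallPointsExist_holds` (landed p106664 as `exists_offWall_mem_polarisedPeriodDomain`) are adapted.
Registered stubs after r3: `stub_nonzeroReducedClass` (lead), `stub_offWallPolarisation` (worker),
`stub_k3TransferFacts` (named facts).
LEAD RESHAPE r4 (prover-line-stmt-HodgeConjecture-14393-c5-0, 2026-08-16, terminal audit of the line):
`stub_offWallPolarisation` is LANDED verbatim (`Theorems.NikulinTwinTransport.stub_offWallPolarisation`,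
p107891, `Theorems/NikulinTwinTransportTwinTwistorTransportOffWallPolarisation.lean`) and is no longer a stub:
the module is imported and `offWallPolarisation_holds` calls the theorem. Registered stubs after r4:
`stub_nonzeroReducedClass` (the heart — kernel-checked EQUIVALENT to the crux modulo the route items
`HodgeIsometryAlgebraic`, `K3PeriodSurjective` and the two named facts, `nonzeroReducedClass_iff_crux`) and
`stub_k3TransferFacts` (named Literature facts `Huybrechts_K3_marking_exists`,
`cupProduct_mem_algebraicClasses_tripleProduct_surfaces`). Nothing else is open: every formal stub of the
line has landed, and what remains is the crux itself plus named-fact debt (see `Lines/reduced-virtual-count-twin-locus.dead.md`).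

Skeleton of the ENUMERATIVE ROAD ("count, don't carry") for the transport crux of route
`NikulinTwinTransport` (crux-plan, planner-cruxplan-stmt-HodgeConjecture-14393-reduced-virtual-coun-0,
2026-08-16), from the triaged crux idea `Cruxes/TwinTwistorTransport/Ideas/reduced-virtual-count-twin-locus.md`
(panel r1: 2/2 pass) and the panel's sharpenings (TRIAGE-r1-1 §reduced-virtual-count (1)–(4);
TRIAGE-r1-2 V1 polarisation-free padding, V2 `ch₃ = 0`, V3 unpadded effectivity at the anchor).

THE CRUX (typed, rev 7, OUTPUT level): every projective K3 surface `S` (integral generator `p` of `H⁴`)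
has a projective K3 partner `S″`, a generator `p″` and an ALGEBRAIC `ℂ`-linear equivalence
`Ψ : H²(S″) ≃ H²(S)` whose inverse is rational, type-preserving and halves the cup form. The tree PROVES
(`Theorems.NikulinTwinTransport.twinTwistorTransport_of_twinTransport`) that the three K3 facts and
`TwinTransportFor[M]` — the twin similitude `η⁻¹ ∘ M ∘ η′` is induced by an algebraic class on every
`M`-twin pair of marked projective K3 surfaces — for ONE rational lattice `2`-similitude `M` with
rational inverse `N` imply the crux BY NAME; this skeleton delivers exactly that input.

THE LINE (Bae–Kool–Park, *Counting surfaces on Calabi–Yau 4-folds I*, arXiv:2208.09474, §1.4–1.5,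
READ: Thm 1.6 reduced Oh–Thomas cycle `[P_v^{(q)}(X)]^{red} ∈ A_{rvd}`, `rvd = n − ½γ² + ½ρ_γ`, on the
projective fine moduli space (Thm 1.3) of `PT_q` pairs with `ch(F) = v = (0,0,γ,β,n − γ·td₂X)` on a
CY4 `X` := smooth projective 4-fold with `K_X ≅ 𝒪` ("in particular hyperkähler or abelian", p. 4);
Thm 1.11 deformation invariance along families on which `ρ_γ` is constant; Thm 1.13: a non-zero
reduced cycle at `X` ⟹ the variational Hodge conjecture for `(X, γ)`; Example 1.14 = `X = S₁ × S₂` a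
product of two K3 surfaces, a NON-semiregular non-zero reduced cycle). Here `X = W = S × S′` runs over
the `h`-polarised `M`-twin pairs, `γ = m·graph(Ψ) + a·[pt × S′] + a′·[S × pt]` (POLARISATION-FREE
padding, V1: `ρ_γ = rk B_γ = 20` at EVERY twin, TRIAGE-r1-1 evidence; with an `h ⊠ h′` term `ρ = 21` and
`rvd ∉ ℤ` kills the class), `β = 0` (V2), `m` even (Disproof T4 / F1: `Ψ` never integral, `2Ψ` is). The
Hodge locus of `γ` in `Def(S) × Def(S′)` is the twin locus and nothing else, so the variational Hodge
conjecture for `(W₀, γ)` (BKP Thm 1.13) runs along the whole universal `h`-polarised twin family, and an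
EMPTY moduli space has zero reduced class: ONE non-zero reduced class at ONE off-wall twin `W₀` (per
polarisation vector `h`) puts a `PT_q` pair `(F, s)`, hence the algebraic class `ch₂(F) = γ`, hence
(`[γ]_* = m·Ψ`, the padding acting by zero on `H²`, divide by `m`) the twin similitude, on every twin pair
of the off-wall component of `W₀`; Hodge-locus spreading (shared with the sibling line) reaches the walls
and the conjugate component. No object is transported, no carrier needs to be unobstructed, stable or
semiregular.

TYPING. Virtual cycles, pair moduli and obstruction theories do not exist in the tree, so the reduced
class enters through a POSITED INTERFACE (planner licence: interface + separate construction statement,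
existence never smuggled into the interface): `TwinSurfaceCount M μ h` = the NON-VANISHING LOCUS
`nonzero ⊆ Λ_ℂ` of the reduced class of the counted admissible class `v` on the `h`-polarised `M`-twin
pairs, indexed by PERIODS (well defined by global Torelli), with BKP's theorem as its one axiom on the
tree's real carriers: `propagate` = Thm 1.13 (the variational Hodge conjecture for `(W_{x₀}, γ)` from a
non-zero reduced class at `x₀`) applied VERBATIM to the universal PROJECTIVE twin family over the
ample × ample locus of a level cover of the Hecke correspondence: non-vanishing at an off-wall period `x₀`
makes the twin similitude algebraic (`GoodPairAt`) at every off-wall period joined to `x₀` inside the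
off-wall part `D_h°` of `D_h` (walls = the `(−2)`-hyperplanes `δ^⊥`, `δ ⊥ h`, and their partners
`(Mδ′)^⊥`, `Mδ′ ⊥ h`, on which `η⁻¹h` resp. `η′⁻¹h′` stop being ample up to re-marking; real codimension
`2`). The construction of an instance TOGETHER WITH its non-vanishing at one off-wall anchor period is the
research stub `stub_nonzeroReducedClass` (an instance alone is trivial: `nonzero := ∅`). The other stubs
are known mathematics: `stub_offWallBall` (walls are locally finite and `D_h` is a manifold: an off-wall
point has a neighbourhood in `D_h` inside `D_h°` all of whose points are joined to it in `D_h°`; size M),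
and — SHARED VERBATIM with the sibling line `semiregular-twin-hodge-locus` (BKP Thm 1.13 "is a virtual
generalization of [BF03]": the two lines differ exactly in the anchor + VHC engine, not in the spreading
and re-marking) — `stub_twinSpread` (goodness on a non-empty open subset of `D_h` spreads to all of `D_h`:
relative Hilbert schemes of the universal twin family are proper, Baire + irreducibility, conjugation for
the other component), `stub_periodInvariance` (re-marking by Buskin, provable now) and
`stub_k3TransferFacts` (the three named K3 facts + composition of correspondences). Composition
(kernel-checked, no `sorry` outside `stub_*`): anchor ⟹ ball `V ∋ x₀` good (`propagate` pointwise) ⟹ all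
of `D_h` good (`TwinSpread`) ⟹ the given marked pair good (`PeriodInvariance`) ⟹ `TwinTransportFor[M]`
⟹ `twinTwistorTransport_of_twinTransport` ⟹ `TwinTwistorTransport` BY NAME (`TwinTwistorTransport_of`).

DISPROOF USED (`Cruxes/TwinTwistorTransport/Disproof.lean`, cdisprove-14393-0 cycle 1, NO KILL, READ):
T1/T1′ "(R) carries the whole content" — honoured inside `anchorAt_of_twinTransport` ((R) for `Ψ⁻¹`
from rationality of `N` via `isRationalClass_markingConj`; here `N` is the rational inverse of the
INTEGRAL lattice similitude of `exists_twoSimilitude_k3Lattice` or of the similitude the anchor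
computation prefers — `stub_nonzeroReducedClass` chooses `M`); T3 `Negative.NoOddSelfAnchor` — `S″` is
the `M`-twin realised by period surjectivity, never `S`; T2/T7 — multiplier `2` is `Latt`'s
`k3Form (M a) (M b) = 2 * k3Form a b`; T4 — `2 ∣ m` recorded in `AdmissibleClass.even_m`; T5/T6/T8/T9
absorbed as recorded there (`∀ μ` threaded through `GoodPairAt`, multiplier `m : ℂ` absorbs the
orientation unit). The landed `Theorems/TwinTwistorTransport/Negative/*` (NikulinParity,
GenericFirstLine, AnchorConeCondition, PolystableCrossTerm, TypedClauseHygiene,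
WithoutRationalityOrHalving, NoOddSelfAnchor) concern the hyperkähler road or the typed clauses and
have no instance among the stubs: no twistor line, no Kähler class, no polystability, no self-anchor.
-/

noncomputable section

set_option linter.dupNamespace false

namespace Summit.HodgeConjecture.HodgeConjecture.Cruxes.TwinTwistorTransport.ReducedVirtualCountTwinLocus

open CategoryTheory MonoidalCategory
open Literature.AlgebraicGeometry.Motives Literature.AlgebraicGeometry.HodgeTheory
open Literature.AlgebraicGeometry.Surfaces
open Literature.AlgebraicTopology.SingularHomology
open Summit.HodgeConjecture.HodgeConjecture.Theses.NikulinTwinTransport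
open Summit.HodgeConjecture.HodgeConjecture.Theorems.NikulinTwinTransport
open Summit.HodgeConjecture.HodgeConjecture.Theorems.NikulinSerreCarrier.NeronSeveriIntertwiner
  (k3Real_orthogonal_re_im)

/-! ## Notation block A — verbatim from `Theorems/NikulinTwinTransportTwinTwistorTransportReduction` -/

local notation3 (prettyPrint := false) "MarkedK3[" S ", " η ", " p ", " x "]" =>
  (IsIntegralClass p ∧
    (∀ q : complexBetti S (2 * 2), IsIntegralClass q → ∃ n : ℤ, q = n • p) ∧
    (∀ c : complexBetti S (2 * 1), IsIntegralClass c ↔ ∃ v : K3Index → ℤ, η c = fun i => (v i : ℂ)) ∧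
    (∀ a b : complexBetti S (2 * 1),
        cupProduct (rfl : 2 * 1 + 2 * 1 = 2 * 2) a b = k3Form (η a) (η b) • p) ∧
    IsOfHodgeType 2 S (2 * 1) 2 0 (LinearEquiv.symm η x) ∧
    (∀ τ : complexBetti S (2 * 1), IsOfHodgeType 2 S (2 * 1) 2 0 τ → ∃ t : ℂ, τ = t • LinearEquiv.symm η x))

local notation3 (prettyPrint := false) "PeriodPt[" x "]" =>
  (k3Form x x = 0 ∧ 0 < (k3Form (star x) x).re ∧
    ∃ u : K3Index → ℤ, k3Form (fun i => (u i : ℂ)) x = 0 ∧ 0 < ∑ i, ∑ j, u i * k3Gram i j * u j)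

local notation3 (prettyPrint := false) "Corr[" μ ", " S ", " S' ", " hS ", " hS' " ; " γ ", " y "]" =>
  complexGysin μ
    (IsSmoothProjective.tensor_holds (IsK3Surface.isSmoothProjective hS)
      (IsK3Surface.isSmoothProjective hS'))
    (IsK3Surface.isSmoothProjective hS) (SemiCartesianMonoidalCategory.fst S S')
    (rfl : 2 * 1 + 2 * 2 + 2 * 2 = 2 * 1 + 2 * (2 + 2))
    (cupProduct (rfl : 2 * 1 + 2 * 2 = 2 * 1 + 2 * 2)
      (complexBetti.map (SemiCartesianMonoidalCategory.snd S S') (2 * 1) y) γ)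

local notation3 (prettyPrint := false) "TwinTransportFor[" M "]" =>
  ∀ (μ : OrientationFamily), μ.HasPoincareDuality →
    ∀ (S S' : SchemeOver ℂ) (hS : IsK3Surface S) (hS' : IsK3Surface S')
      (η : complexBetti S (2 * 1) ≃ₗ[ℂ] (K3Index → ℂ)) (p : complexBetti S (2 * 2))
      (x : K3Index → ℂ)
      (η' : complexBetti S' (2 * 1) ≃ₗ[ℂ] (K3Index → ℂ)) (p' : complexBetti S' (2 * 2))
      (x' : K3Index → ℂ),
      MarkedK3[S, η, p, x] → PeriodPt[x] → MarkedK3[S', η', p', x'] → PeriodPt[x'] →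
      (∃ t : ℂ, M x' = t • x) →
      ∃ γ ∈ algebraicClasses (MonoidalCategoryStruct.tensorObj S S') 2,
        ∀ y : complexBetti S' (2 * 1), η.symm (M (η' y)) = Corr[μ, S, S', hS, hS' ; γ, y]

/-! ## Notation block B — shared with the sibling line `semiregular-twin-hodge-locus` (verbatim) -/

/-- `Latt[M, N]`: `M` is a rational `2`-similitude of `(Λ_ℂ, k3Form)` with rational two-sided inverse `N`
(verbatim the conclusion of `exists_twoSimilitude_k3Lattice`). -/
local notation3 (prettyPrint := false) "Latt[" M ", " N "]" =>
  ((∀ v : K3Index → ℤ, ∃ w : K3Index → ℚ, M (fun i => (v i : ℂ)) = fun i => (w i : ℂ)) ∧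
    (∀ v : K3Index → ℤ, ∃ w : K3Index → ℚ, N (fun i => (v i : ℂ)) = fun i => (w i : ℂ)) ∧
    M * N = 1 ∧ N * M = 1 ∧
    (∀ a b, k3Form (M a) (M b) = 2 * k3Form a b))

/-- `PolPeriod[h, x]`: `x` is a period point polarised by the lattice vector `h` — `(x.x) = 0`, `(x̄.x) > 0`,
`(h.x) = 0` (the points of `D_h = D ∩ h^⊥`; definitionally `x ∈ Surfaces.polarisedPeriodDomain h`). -/
local notation3 (prettyPrint := false) "PolPeriod[" h ", " x "]" =>
  (k3Form x x = 0 ∧ 0 < (k3Form (star x) x).re ∧ k3Form (fun i => ((h : K3Index → ℤ) i : ℂ)) x = 0)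

/-- `Good[M, μ, S, S', hS, hS', η, η']`: the twin similitude `η⁻¹ ∘ M ∘ η'` is induced by an algebraic class. -/
local notation3 (prettyPrint := false) "Good[" M ", " μ ", " S ", " S' ", " hS ", " hS' ", " η ", " η' "]" =>
  ∃ γ ∈ algebraicClasses (MonoidalCategoryStruct.tensorObj S S') 2,
    ∀ y : complexBetti S' (2 * 1), (η : complexBetti S (2 * 1) ≃ₗ[ℂ] (K3Index → ℂ)).symm
      (M ((η' : complexBetti S' (2 * 1) ≃ₗ[ℂ] (K3Index → ℂ)) y)) = Corr[μ, S, S', hS, hS' ; γ, y]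

/-- `GoodPairAt[M, μ, x]`: SOME marked projective `M`-twin pair with first period `x` has an
algebraic twin similitude. -/
local notation3 (prettyPrint := false) "GoodPairAt[" M ", " μ ", " x "]" =>
  ∃ (S S' : SchemeOver ℂ) (hS : IsK3Surface S) (hS' : IsK3Surface S')
    (η : complexBetti S (2 * 1) ≃ₗ[ℂ] (K3Index → ℂ)) (p : complexBetti S (2 * 2))
    (η' : complexBetti S' (2 * 1) ≃ₗ[ℂ] (K3Index → ℂ)) (p' : complexBetti S' (2 * 2))
    (x' : K3Index → ℂ),
    MarkedK3[S, η, p, x] ∧ PeriodPt[x] ∧ MarkedK3[S', η', p', x'] ∧ PeriodPt[x'] ∧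
    (∃ t : ℂ, M x' = t • x) ∧ Good[M, μ, S, S', hS, hS', η, η']

/-- `CorrComp`: composition of algebraic correspondences between K3 surfaces is induced by an algebraic class
(verbatim the hypothesis `hcomp` of `twinSimilitudeAlgebraic_of_twinTransport`; Buskin Lemma 6.3 / Fulton Prop. 16.1.1). -/
local notation3 (prettyPrint := false) "CorrComp[]" =>
  ∀ (μ : OrientationFamily), μ.HasPoincareDuality →
    ∀ (S S' S'' : SchemeOver ℂ) (hS : IsK3Surface S) (hS' : IsK3Surface S') (hS'' : IsK3Surface S''),
    ∀ γ ∈ algebraicClasses (MonoidalCategoryStruct.tensorObj S S') 2,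
    ∀ γ' ∈ algebraicClasses (MonoidalCategoryStruct.tensorObj S' S'') 2,
    ∃ γ'' ∈ algebraicClasses (MonoidalCategoryStruct.tensorObj S S'') 2,
      ∀ y : complexBetti S'' (2 * 1),
        Corr[μ, S, S'', hS, hS'' ; γ'', y] = Corr[μ, S, S', hS, hS' ; γ, Corr[μ, S', S'', hS', hS'' ; γ', y]]

/-! ## Notation block C — this line -/

/-- `OffWall[M, h, x]`: the period `x` lies on none of the `(−2)`-WALLS of the `h`-polarised `M`-twin family —
no root `δ ∈ Λ` (`δ² = −2`) orthogonal to `h` is orthogonal to `x` (on the marked K3 `S_x`, `η⁻¹h` meets every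
`(−2)`-class, i.e. lies in an open Weyl chamber: ample up to re-marking by `W(NS) × {±1}`, which fixes the
period), and no `Mδ′`, `δ′` a root with `Mδ′ ⊥ h`, is orthogonal to `x` (the same for the partner `S′_{x′}`,
`x′ ∝ N x`, `h′ ∝ N h`: `(δ′.Nx) = ½(Mδ′.x)`, `(δ′.Nh) = ½(Mδ′.h)`). Off the walls both universal families
are PROJECTIVE (relatively ample `h`, `h′`) — the setting of BKP Thm 1.13 verbatim. -/
local notation3 (prettyPrint := false) "OffWall[" M ", " h ", " x "]" =>
  ((∀ δ : K3Index → ℤ, ∑ i, ∑ j, δ i * k3Gram i j * δ j = -2 →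
      ∑ i, ∑ j, δ i * k3Gram i j * (h : K3Index → ℤ) j = 0 → k3Form (fun i => (δ i : ℂ)) x ≠ 0) ∧
    (∀ δ : K3Index → ℤ, ∑ i, ∑ j, δ i * k3Gram i j * δ j = -2 →
      k3Form ((M : Module.End ℂ (K3Index → ℂ)) (fun i => (δ i : ℂ))) (fun i => ((h : K3Index → ℤ) i : ℂ)) = 0 →
      k3Form ((M : Module.End ℂ (K3Index → ℂ)) (fun i => (δ i : ℂ))) x ≠ 0))

/-- `OffWallLocus[M, h]`: the off-wall part `D_h°` of the polarised period domain. -/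
local notation3 (prettyPrint := false) "OffWallLocus[" M ", " h "]" =>
  {y : K3Index → ℂ | y ∈ polarisedPeriodDomain (h : K3Index → ℤ) ∧ OffWall[M, h, y]}

/-! ## The counted class (documentary bookkeeping of BKP's `v`; only the locus below is consumed by the typed chain) -/

/-- **The admissible numerical class counted on the twin fourfolds** `W = S × S′` (BKP §1.4:
`ch(F) = v = (0, 0, γ, β, n − γ·td₂(W))`, `PT_q`-stability, `q ∈ {−1, 0, 1}`), in the shape the panel
forced: `γ = m·graph(Ψ) + a·[pt × S′] + a′·[S × pt]` POLARISATION-FREE (TRIAGE-r1-2 V1: then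
`ρ_γ = 20` at every twin and `rvd ∈ ℤ`; an `h ⊠ h′` term gives `ρ_γ = 21`, odd-rank reduced obstruction
bundle, zero class), `β = ch₃ = 0` (V2: a curve-class `ch₃` produces a nowhere-zero isotropic cosection
and kills the reduced class), `m ≠ 0` EVEN (`Ψ` is never integral, `2Ψ` is: Disproof T4 / cdisprove
gen-1 integrality record; `ch₂(F) = −c₂(F)` is integral when `c₁ = 0`), the Cauchy–Schwarz bound
`a·a′ ≥ 2m²` NECESSARY for an effective representative anywhere (V3; equality = Lagrangian type,
`d₁d₂ = 2m²` of the Voisin card), and NON-NEGATIVE REDUCED VIRTUAL DIMENSION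
`rvd = n − ½γ² + ½ρ_γ = n − (22m² + a·a′) + 10 ≥ 0` (`γ² = 44m² + 2aa′`: `graph(Ψ)² = 2·22`,
`[pt×S′]·[S×pt] = 1`; a class in `A_{rvd}` with `rvd < 0` is zero). These fields are consumed only
informally (the count they index is the posited `TwinSurfaceCount` below); they record which Chern
characters the line may count. [cite: arXiv:2208.09474, §1.4, Thm. 1.6] -/
structure AdmissibleClass : Type where
  /-- Multiplier of `graph(Ψ)` in `γ = ch₂(F)`. -/
  m : ℤ
  /-- Coefficient of `[pt × S′]`. -/
  a : ℤ
  /-- Coefficient of `[S × pt]`. -/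
  a' : ℤ
  /-- BKP's `n` (`ch₄(F) = n − γ·td₂(W)`; for pure `F`, `n = χ(F)`). -/
  n : ℤ
  /-- The stability parameter `q` of `PT_q` pairs. -/
  q : ℤ
  m_ne_zero : m ≠ 0
  even_m : 2 ∣ m
  q_mem : q = -1 ∨ q = 0 ∨ q = 1
  two_mul_sq_le : 2 * m ^ 2 ≤ a * a'
  rvd_nonneg : 0 ≤ n - (22 * m ^ 2 + a * a') + 10

namespace AdmissibleClass

/-- `γ² = 44m² + 2aa′` for `γ = m·graph(Ψ) + a·[pt × S′] + a′·[S × pt]` (`graph(Ψ)² = 2·22 = 44` for a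
`2`-similitude of a rank-`22` lattice, TRIAGE-r1-1; mixed products vanish except `[pt×S′]·[S×pt] = 1`). -/
def gammaSq (v : AdmissibleClass) : ℤ := 44 * v.m ^ 2 + 2 * (v.a * v.a')

/-- BKP's reduced virtual dimension `rvd = n − ½γ² + ½ρ_γ` with `ρ_γ = 20` (rank of Bloch's form `B_γ` on
`H¹(T_W) = H¹(T_S) ⊕ H¹(T_{S′})` at a twin: the cross block `(κ, λ′) ↦ (Ψ a(λ′), a(κ))` is non-degenerate of
rank `20` at EVERY twin, TRIAGE-r1-1), as an integer. [cite: arXiv:2208.09474, Thm. 1.6] -/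
def rvd (v : AdmissibleClass) : ℤ := v.n - (22 * v.m ^ 2 + v.a * v.a') + 10

/-- `2·rvd = 2n − γ² + ρ_γ` with `ρ_γ = 20`: the integer `rvd` above IS BKP's `n − ½γ² + ½ρ_γ`. -/
theorem two_mul_rvd (v : AdmissibleClass) : 2 * v.rvd = 2 * v.n - v.gammaSq + 20 := by
  simp only [rvd, gammaSq]; ring

/-- The recorded inequality is `rvd ≥ 0`. -/
theorem rvd_nonneg' (v : AdmissibleClass) : 0 ≤ v.rvd := v.rvd_nonneg

/-- Anti-vacuity of the bookkeeping: the Lagrangian-type class `m = 2`, `(a, a′) = (2, 4)` (`aa′ = 8 = 2m²`),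
`n = 86` (`rvd = 0`), `PT₁` pairs, is admissible. -/
def lagrangianType : AdmissibleClass where
  m := 2
  a := 2
  a' := 4
  n := 86
  q := 1
  m_ne_zero := by norm_num
  even_m := ⟨1, by norm_num⟩
  q_mem := Or.inr (Or.inr rfl)
  two_mul_sq_le := by norm_num
  rvd_nonneg := by norm_num

/-- Its reduced virtual dimension is `0` (an isolated count, as in BKP Ex. 1.8 / the multiplier-`1` toy
`𝒪_Δ` on `S × S`: `2 − 12 + 10 = 0`). -/
theorem rvd_lagrangianType : lagrangianType.rvd = 0 := by
  simp [rvd, lagrangianType]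

end AdmissibleClass

/-! ## The posited interface: the non-vanishing locus of the reduced surface count on the `h`-polarised twin family -/

/-- **INTERFACE (posited object — its construction is part of `stub_nonzeroReducedClass`, never assumed).**
A REDUCED SURFACE COUNT for the lattice `2`-similitude `M` on the `h`-polarised `M`-twin pairs: the data of
an admissible counted class `v` and of the NON-VANISHING LOCUS `nonzero ⊆ Λ_ℂ` — the set of period vectors
`x` (meaningful on `D_h = polarisedPeriodDomain h`) of `h`-polarised marked `M`-twin pairs
`W_x = S_x × S′_x` for which the reduced Oh–Thomas cycle `[P_v^{(q)}(W_x)]^{red} ∈ A_{rvd}` of BKP Thm 1.6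
(transversal slice `V` = the `20` twin-normal directions of `H¹(T_{W_x})`), restricted to some union of
connected components of the projective fine moduli space `P_v^{(q)}(W_x)` (Thm 1.3), is NON-ZERO — well
defined on periods by the global Torelli theorem (marked pairs with the same periods are isomorphic) —
subject to ONE axiom, BKP's Thm 1.13 on the tree's real carriers:
* `propagate` — if `x₀ ∈ nonzero` is off the walls, then at every off-wall period `x` joined to `x₀` inside
  the off-wall locus `D_h°` SOME marked `M`-twin pair with first period `x` has an algebraic twin similitude.
  In print: the universal `h`/`h′`-polarised `M`-twin family over a torsion-free level cover `B` of the Hecke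
  correspondence (`≅ Γ_M\D_h`, `Γ_M` commensurable with `O(Λ)`; Baily–Borel: `B` smooth quasi-projective;
  Huybrechts Ch. 6 §4.2: universal families exist on level covers) restricted to the ample × ample locus
  `B°` (the image of `D_h°`; Zariski open, connected over each component of `D_h°`) is a smooth PROJECTIVE
  family of Calabi–Yau fourfolds `W_b = S_b × S′_b` over a smooth connected base, and
  `γ̃ = m·graph(Ψ_b) + a·[pt × S′] + a′·[S × pt]` is a horizontal section of `F²H⁴_{dR}` on it (every fibre is
  a twin); Thm 1.13 (the variational Hodge conjecture, Conj. 1.12, for `(W_{x₀}, γ)` from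
  `[P_v^{(q)}(W_{x₀})]^{red} ≠ 0`) makes `γ̃_b` ALGEBRAIC on every fibre; `γ̃_b` acts on `H²(S′_b)` as
  `m·(η_b⁻¹ ∘ M ∘ η′_b)` (point paddings act by zero for degree reasons) and `m ≠ 0` is divided out inside
  the `ℂ`-subspace `algebraicClasses` (absorbing also the orientation unit of `μ`, Disproof T8):
  `GoodPairAt[M, μ, x]`, witnessed by the fibre pair over `[x]` with its period representative rescaled to
  `x`.
Propagation is ONE-SIDED and GLOBAL (non-vanishing ⟹ non-emptiness of the pair moduli space on the whole
connected projective family; the reduced CYCLE itself need not stay non-zero under specialisation), exactly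
the content of BKP's proof of Thm 1.13; the walls (real codimension `2`, where the universal family is
only proper) are reached afterwards by spreading (`TwinSpread`), not by BKP. An instance ALONE is trivial
(`nonzero := ∅`); the research content is an instance with an off-wall point in its locus
(`stub_nonzeroReducedClass`).
[cite: arXiv:2208.09474, Thm. 1.3, Thm. 1.6, Thm. 1.11, Conj. 1.12, Thm. 1.13, Example 1.14]
[cite: Huybrechts2016K3, Ch. 6 §4.2 (level structures, universal family), Ch. 6 Rem. 1.6, Ch. 7 Thm. 5.3 (global Torelli), Ch. 8 §2 (ample cone, chambers and walls)] -/
structure TwinSurfaceCount (M : Module.End ℂ (K3Index → ℂ)) (μ : OrientationFamily) (h : K3Index → ℤ) :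
    Type where
  /-- The counted admissible class `v = (0, 0, m·graphΨ + a f + a′ f′, 0, n − γ·td₂)`, `PT_q`. -/
  cls : AdmissibleClass
  /-- The non-vanishing locus of the reduced class, as a set of period vectors (meaningful on `D_h`). -/
  nonzero : Set (K3Index → ℂ)
  /-- **BKP Thm 1.13 on the universal projective twin family**: a non-zero reduced class at an off-wall
  period makes the twin similitude algebraic at every off-wall period in the same path component of the
  off-wall locus `D_h°`. [cite: arXiv:2208.09474, Thm. 1.13 and Conj. 1.12] -/
  propagate : ∀ x₀ ∈ polarisedPeriodDomain h, ∀ x ∈ polarisedPeriodDomain h,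
      OffWall[M, h, x₀] → OffWall[M, h, x] → JoinedIn OffWallLocus[M, h] x₀ x →
        x₀ ∈ nonzero → GoodPairAt[M, μ, x]

/-! ## The stub statements (precise `Prop`s; the sorried `stub_*` theorems below are the REGISTERED stubs) -/

/-- **Stub 1 · NonzeroReducedClass** (THE RESEARCH HEART — construction of BKP's reduced count on the twin
family AND its non-vanishing at one anchor in EVERY deformation class; open, hardest; COMPONENT-WISE FORM
since lead reshape r3). For SOME rational `2`-similitude `M` of the K3 lattice with rational inverse `N` (the
line may pick the one adapted to its anchors: `exists_twoSimilitude_k3Lattice`, or the Kummer-`2`-isogeny /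
Nikulin completion), every orientation family `μ`, every polarisation vector `h` (`h² > 0`) and every
OFF-WALL period `x ∈ D_h` admit a `TwinSurfaceCount M μ h` whose non-vanishing locus contains an anchor `x₀`
JOINED TO `x` INSIDE THE OFF-WALL LOCUS `D_h°` — i.e. a non-zero reduced class at one twin pair of each
connected deformation family of off-wall `h`-polarised `M`-twin pairs (BKP Thm 1.11: the reduced class is
deformation invariant along each such family, `ρ_γ = 20` throughout, so its non-vanishing locus is a union
of components of `D_h°`; the components of `D_h°` are those of `D_h = D_h⁺ ⊔ D_h⁻`, swapped by conjugation
of varieties, under which a count keeps its absolute value — so informally ONE non-zero count per `h`, as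
before; r3 moves this component bookkeeping from the dropped formal stub `TwinSpread` into the research
stub, where BKP's deformation invariance pays for it). Informal proof obligation = C⁺ of the card
as sharpened by the panel: at ONE such anchor `W₀ = S₀ × S₀′` (Kummer `2`-isogeny twins `(Km A, Km A′)`
first — V3: at generic Nikulin anchors `m·graphΨ + a f + a′f′` has NO effective representative short of an
exotic isogeny surface, so the moduli space is empty and the class zero there), for ONE admissible `v`, ONE
connected component `P_c` of `P_v^{(q)}(W₀)` carries `[P]^{red}|_{P_c} ≠ 0` — e.g. a smooth excess
component with `c_top(Ob^{red}) ≠ 0` computed by virtual pull-back as in BKP Ex. 1.14 (`|𝒪(β₁)| × ℙ¹`,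
reduced cycle `± h⁰·[pt × ℙ¹]`), or a component smooth of dimension `rvd` (a semiregular pair, Thm 1.7 —
the case that subsumes the sibling semiregular line). Why it might fail: the reduced class may vanish for
every admissible `v` at every anchor (no admissible class effective at any twin, V3; hidden cosections
beyond the `20` twin directions; cancelling components), no torus acts on a K3 (no localisation: the
computation is a research project — Kummer `(ℤ/2)⁴`-quotient geometry of `A × A′`, degeneration, or the
DT/PT wall-crossing of BKP II–III), and small degrees `2d` may lack an off-wall anchor of the chosen species.
[cite: arXiv:2208.09474, Thm. 1.6, Thm. 1.7, Thm. 1.13, Example 1.14] -/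
def NonzeroReducedClass : Prop :=
  ∃ (M N : Module.End ℂ (K3Index → ℂ)), Latt[M, N] ∧
    ∀ (μ : OrientationFamily), μ.HasPoincareDuality →
      ∀ (h : K3Index → ℤ), 0 < ∑ i, ∑ j, h i * k3Gram i j * h j →
        ∀ x ∈ polarisedPeriodDomain h, OffWall[M, h, x] →
          ∃ (Z : TwinSurfaceCount M μ h) (x₀ : K3Index → ℂ),
            JoinedIn OffWallLocus[M, h] x₀ x ∧ x₀ ∈ Z.nonzero

/-- **OffWallBall** (DERIVED since lead reshape r1 — see `offWallBall_of`; it was Stub 2 of the planner's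
skeleton). For a rational lattice `2`-similitude `(M, N)` and `h` with `h² > 0`, every off-wall point `x₀`
of `D_h` has an open neighbourhood `V` in `Λ_ℂ` such that every point of `V ∩ D_h` is off-wall and is
joined to `x₀` by a path inside the off-wall locus `D_h°`. It is the conjunction of two independent
topological facts, now the registered stubs `stub_offWallStable` and `stub_periodDomainLocPathConnected`.
[cite: Huybrechts2016K3, Ch. 6 §1.1 and Rem. 1.6; Ch. 8 §2.2 Rem. 2.2 (the union of the walls is closed and locally finite)] -/
def OffWallBall : Prop :=
  ∀ (M N : Module.End ℂ (K3Index → ℂ)), Latt[M, N] →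
    ∀ (h : K3Index → ℤ), 0 < ∑ i, ∑ j, h i * k3Gram i j * h j →
      ∀ x₀ ∈ polarisedPeriodDomain h, OffWall[M, h, x₀] →
        ∃ V : Set (K3Index → ℂ), IsOpen V ∧ x₀ ∈ V ∧
          ∀ z ∈ V, z ∈ polarisedPeriodDomain h → OffWall[M, h, z] ∧ JoinedIn OffWallLocus[M, h] x₀ z

/-- **Stub 2a · OffWallStable** (known topology; size M–L; lead reshape r1, first half of `OffWallBall`).
OFF-WALL IS AN OPEN CONDITION ON `D_h`: for a rational lattice `2`-similitude `(M, N)`, `h` with `h² > 0`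
and an off-wall point `x₀ ∈ D_h`, there is `ε > 0` such that every point of `D_h` within distance `ε`
of `x₀` (sup metric of `K3Index → ℂ`; any metric works) is off-wall. Proof sketch (local finiteness of
the walls, Huybrechts Ch. 8 Rem. 2.2 / Ch. 6 Rem. 1.6): for `z ∈ D_h` the real `3`-space
`Π_z = ⟨Re z, Im z, h⟩ ⊂ Λ_ℝ` is positive definite (`(z.z) = 0`, `(z̄.z) > 0`, `(h.z) = 0`, `h² > 0`), and
since `Λ_ℝ` has signature `(3, 19)` (`K3MarkingProofs.signature_toBilin'_k3Gram`, or directly: the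
`19`-dimensional span of `E₈(−1)^{⊕2}` and the `eᵢ − fᵢ` is negative definite) its orthogonal complement
is negative definite; a wall vector through `z` is a `w ⊥ Π_z` with `w ∈ Λ`, `w² = −2` (first family,
`w = δ`) or `w ∈ M(Λ)`, `w² = −4` (second family, `w = Mδ′`, `(Mδ′)² = 2δ′²`), both DISCRETE subsets of
`Λ_ℝ` (`M` is defined over `ℚ` with inverse `N` over `ℚ`: `M(ℤ²²) ⊆ (1/d)ℤ²²`); uniformly for `z` in a
small closed ball around `x₀`, `w ⊥ Π_z` forces `‖w‖² ≤ C · (−w²) ≤ 4C` (negative definiteness of the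
form on `Π_{x₀}^⊥` plus `|Π_{x₀}`-component of `w| ≤ c‖w‖·‖z − x₀‖`), so only FINITELY many wall vectors
have a wall meeting the ball; each has `(w.x₀) ≠ 0` (`x₀` off-wall), hence `(w.z) ≠ 0` for `z` in a
smaller ball. [cite: Huybrechts2016K3, Ch. 8 §2.2 Rem. 2.2 and Ch. 6 Rem. 1.6 (walls are locally finite)] -/
def OffWallStable : Prop :=
  ∀ (M N : Module.End ℂ (K3Index → ℂ)), Latt[M, N] →
    ∀ (h : K3Index → ℤ), 0 < ∑ i, ∑ j, h i * k3Gram i j * h j →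
      ∀ x₀ ∈ polarisedPeriodDomain h, OffWall[M, h, x₀] →
        ∃ ε : ℝ, 0 < ε ∧ ∀ z ∈ polarisedPeriodDomain h, dist z x₀ < ε → OffWall[M, h, z]

/-- **Stub 2b · PeriodDomainLocPathConnected** (known topology; size M–L; lead reshape r1, second half of
`OffWallBall`). THE POLARISED PERIOD DOMAIN IS LOCALLY PATH-CONNECTED, quantitatively: for `h² > 0`,
`x₀ ∈ D_h` and `ε > 0` there is an open `V ∋ x₀` such that every `z ∈ V ∩ D_h` is joined to `x₀` by a
path INSIDE `D_h ∩ B(x₀, ε)`. Proof sketch: write `x = a + ib` (`a, b ∈ Λ_ℝ`); `x ∈ D_h` iff `a ⊥ b`,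
`a² = b² > 0`, `a, b ⊥ h` (real form `k3RForm`, `K3TwistorLines.mem_k3PeriodDomain_iff_k3RForm`). For
`z = a₁ + ib₁` near `x₀ = a₀ + ib₀` the explicit path `a_t = (1−t)a₀ + t a₁`,
`b′_t = b̃_t − ((b̃_t.a_t)/(a_t.a_t)) a_t` with `b̃_t = (1−t)b₀ + t b₁`, `b_t = √((a_t.a_t)/(b′_t.b′_t)) b′_t`,
`x_t = a_t + i b_t` stays in `D_h` (Gram–Schmidt in the positive definite plane; `a_t² > 0`, `b′_t² > 0`
near `x₀`), is continuous in `(z, t)`, constant when `z = x₀`; by compactness of `[0,1]`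
(`IsCompact.eventually_forall_of_forall_eventually`) it stays in `B(x₀, ε)` for `z` in some open
`V ∋ x₀`. Alternatively: `D_h` is an open subset of the smooth real-analytic manifold
`{(x.x) = 0, (h.x) = 0} ∖ {0}` (`h^⊥` non-degenerate), and manifolds are locally path-connected
(implicit function theorem). [cite: Huybrechts2016K3, Ch. 6 §1.1 and §2.4 (the period domain and `D_h` are complex manifolds)] -/
def PeriodDomainLocPathConnected : Prop :=
  ∀ (h : K3Index → ℤ), 0 < ∑ i, ∑ j, h i * k3Gram i j * h j →
    ∀ x₀ ∈ polarisedPeriodDomain h, ∀ ε : ℝ, 0 < ε →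
      ∃ V : Set (K3Index → ℂ), IsOpen V ∧ x₀ ∈ V ∧
        ∀ z ∈ V, z ∈ polarisedPeriodDomain h →
          JoinedIn (polarisedPeriodDomain h ∩ Metric.ball x₀ ε) x₀ z

/-- **Stub 3 · OffWallPolarisation** (lattice theory; size L; lead reshape r3, REPLACING the formal-XL stub
`TwinSpread`). Every projective period point `x` (`PeriodPt[x]`: `(x.x) = 0`, `(x̄.x) > 0`, some lattice
vector `u ⊥ x` with `u² > 0`) admits, for every rational lattice `2`-similitude `(M, N)`, a polarisation
vector `h ∈ Λ` with `h² > 0`, `x ∈ D_h`, for which `x` is OFF-WALL. Why true: inside the real span `V` of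
`NS_x := x^⊥ ∩ Λ_ℚ` (hyperbolic: it contains `u` and lies in `⟨Re x, Im x⟩^⊥`, signature `(1, 19)`), the
wall vectors through `x` — roots `δ ∈ Λ ∩ x^⊥` and `Mδ′ ∈ x^⊥` (`δ′` a root; `Mδ′ ∈ (1/d)Λ`) — are vectors
of square `−2`, `−4` of a discrete set, and those orthogonal to some `k` in a small neighbourhood of `u` are
orthogonal to the positive `3`-frame `(Re x, Im x, k)`, hence of bounded norm (`k3Real_uniform_neg_near`,
with the roles of `z` and `c` exchanged: `x` fixed, `k` near `u`), hence FINITELY many (`twinWalls_finite_near`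
pattern); choose `e ∈ NS_x` off the finitely many hyperplanes `w^⊥` with `w ⊥ u` (moment-curve choice
`e = Σ nⁱ bᵢ` on a basis of `NS_x`) and `h := t·u + e`, `t ∈ ℕ` large: then `(w.h) ≠ 0` for every wall
vector `w` relevant near the ray of `u`, `h² > 0`, `h ⊥ x`. [cite: Huybrechts2016K3, Ch. 8 §2.2 Rem. 2.2 (walls are locally finite in the positive cone) and Ch. 6 Rem. 1.6] -/
def OffWallPolarisation : Prop :=
  ∀ (M N : Module.End ℂ (K3Index → ℂ)), Latt[M, N] →
    ∀ x : K3Index → ℂ, PeriodPt[x] →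
      ∃ h : K3Index → ℤ, 0 < ∑ i, ∑ j, h i * k3Gram i j * h j ∧
        x ∈ polarisedPeriodDomain h ∧ OffWall[M, h, x]

/-- **PeriodInvariance** (re-marking by Buskin — LANDED: `Theorems.NikulinTwinTransport.stub_periodInvariance`,
p95441, verbatim this statement; no longer a stub since lead reshape r1). Goodness of ONE marked `M`-twin
pair with first period `x` passes to EVERY marked `M`-twin pair `(S, η, p, x₂; S', η', p', x')` with
`x₂ ∈ ℂ x`. [cite: Buskin2019, Thm. 1.1 and §6.2] -/
def PeriodInvariance : Prop :=
  ∀ (M N : Module.End ℂ (K3Index → ℂ)), Latt[M, N] →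
    ∀ (μ : OrientationFamily), μ.HasPoincareDuality →
      HodgeIsometryAlgebraic → Huybrechts_K3_hodgeTypes_H2 → CorrComp[] →
      ∀ (x : K3Index → ℂ), GoodPairAt[M, μ, x] →
        ∀ (S S' : SchemeOver ℂ) (hS : IsK3Surface S) (hS' : IsK3Surface S')
          (η : complexBetti S (2 * 1) ≃ₗ[ℂ] (K3Index → ℂ)) (p : complexBetti S (2 * 2)) (x₂ : K3Index → ℂ)
          (η' : complexBetti S' (2 * 1) ≃ₗ[ℂ] (K3Index → ℂ)) (p' : complexBetti S' (2 * 2)) (x' : K3Index → ℂ),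
          MarkedK3[S, η, p, x₂] → PeriodPt[x₂] → MarkedK3[S', η', p', x'] → PeriodPt[x'] →
          (∃ t : ℂ, M x' = t • x₂) → (∃ s : ℂ, x₂ = s • x) →
          Good[M, μ, S, S', hS, hS', η, η']

/-- `PeriodInvariance` holds: the landed theorem (p95441). -/
theorem periodInvariance_holds : PeriodInvariance := stub_periodInvariance

/-- **Stub 5 · K3TransferFacts** (named Literature facts, NOT research; lead reshape r1). The two inputs of
the composition that are published theorems recorded in the tree as still-unproved named facts:
existence of markings with projective periods (`Huybrechts_K3_marking_exists`, Huybrechts Ch. 1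
Prop. 3.5 with Ch. 6 Prop. 1.2; in-tree assembly `Huybrechts_K3_marking_exists_holds_of` modulo
`K3_finrank_complexBetti_two`, `K3_even_intersectionForm`,
`K3_exists_orientation_signature_hodgeRiemann_ample`, `Voisin2002_closedForm_top_zero_not_exact`,
`hodgePQ_independent_of_hodgeModel`) and the multiplicativity `N² ∪ N² ⊆ N⁴` of algebraic classes on
triple products of surfaces (`cupProduct_mem_algebraicClasses_tripleProduct_surfaces`, Voisin II
Prop. 9.20, the moving lemma), from which `CorrComp[]` follows by `corrComp_surfaces_of_cup'`
(`corrComp_of_cupAlg` below). Dropped from the planner's conjunction: `Huybrechts_K3_hodgeTypes_H2`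
(now the theorem `Huybrechts_K3_hodgeTypes_H2_holds`) and period surjectivity (the route crux
`K3PeriodSurjective`, a hypothesis of the composition by name).
[cite: Huybrechts2016K3, Ch. 1 Prop. 3.5 and Ch. 6 Prop. 1.2] [cite: VoisinHodgeII2003, §9.2.4 Prop. 9.20] -/
def K3TransferFacts : Prop :=
  Huybrechts_K3_marking_exists ∧ cupProduct_mem_algebraicClasses_tripleProduct_surfaces

/-! ## Registered stubs (sorried witnesses; `sorry` occurs nowhere else in this file) -/

/-- Stub 1 (registered): see `NonzeroReducedClass`. -/
theorem stub_nonzeroReducedClass :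
    ∃ (M N : Module.End ℂ (K3Index → ℂ)), Latt[M, N] ∧
      ∀ (μ : OrientationFamily), μ.HasPoincareDuality →
        ∀ (h : K3Index → ℤ), 0 < ∑ i, ∑ j, h i * k3Gram i j * h j →
          ∀ x ∈ polarisedPeriodDomain h, OffWall[M, h, x] →
            ∃ (Z : TwinSurfaceCount M μ h) (x₀ : K3Index → ℂ),
              JoinedIn OffWallLocus[M, h] x₀ x ∧ x₀ ∈ Z.nonzero := by
  sorry

/-- Stub 2a `stub_offWallStable` — LANDED (p99899, `Theorems.NikulinTwinTransport.stub_offWallStable`,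
wave 1 of the lead's continuation): `OffWallStable` holds. -/
theorem offWallStable_holds : OffWallStable := stub_offWallStable

/-- Stub 2b `stub_periodDomainLocPathConnected` — LANDED (p101842,
`Theorems.NikulinTwinTransport.stub_periodDomainLocPathConnected`, wave 1): `PeriodDomainLocPathConnected`
holds. -/
theorem periodDomainLocPathConnected_holds : PeriodDomainLocPathConnected :=
  stub_periodDomainLocPathConnected

/-- Stub 3 `stub_offWallPolarisation` — LANDED (p107891,
`Theorems.NikulinTwinTransport.stub_offWallPolarisation`, verbatim the registered statement; lead reshape r4):
`OffWallPolarisation` holds. -/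
theorem offWallPolarisation_holds : OffWallPolarisation :=
  Summit.HodgeConjecture.HodgeConjecture.Theorems.NikulinTwinTransport.stub_offWallPolarisation

/-- Stub 5 (registered): see `K3TransferFacts`. -/
theorem stub_k3TransferFacts :
    Huybrechts_K3_marking_exists ∧ cupProduct_mem_algebraicClasses_tripleProduct_surfaces := by
  sorry

/-! ## The composition (kernel-checked; no `sorry` below this line) -/

/-- `OffWallBall` from its two halves: an off-wall point has a wall-free ball of radius `ε`
(`OffWallStable`), and the points of `D_h` near it are joined to it inside `D_h ∩ B(x₀, ε)`
(`PeriodDomainLocPathConnected`), hence inside the off-wall locus. -/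
theorem offWallBall_of (hA : OffWallStable) (hB : PeriodDomainLocPathConnected) : OffWallBall := by
  intro M N hlatt h hh x₀ hx₀D hx₀W
  obtain ⟨ε, hε, hball⟩ := hA M N hlatt h hh x₀ hx₀D hx₀W
  obtain ⟨V, hVo, hx₀V, hV⟩ := hB h hh x₀ hx₀D ε hε
  refine ⟨V, hVo, hx₀V, fun z hzV hzD => ?_⟩
  have hJ := hV z hzV hzD
  have hsub : polarisedPeriodDomain h ∩ Metric.ball x₀ ε ⊆ OffWallLocus[M, h] := fun y hy =>
    ⟨hy.1, hball y hy.1 (Metric.mem_ball.1 hy.2)⟩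
  have hzε : z ∈ polarisedPeriodDomain h ∩ Metric.ball x₀ ε := hJ.target_mem
  exact ⟨hball z hzD (Metric.mem_ball.1 hzε.2), hJ.mono hsub⟩

/-- `CorrComp[]` (composition of algebraic correspondences between K3 surfaces) from the named fact
`cupProduct_mem_algebraicClasses_tripleProduct_surfaces`, by the tree's unconditional
`corrComp_surfaces_of_cup'` (Gysin base change from the Künneth theorem). -/
theorem corrComp_of_cupAlg (hCUP : cupProduct_mem_algebraicClasses_tripleProduct_surfaces) : CorrComp[] :=
  fun μ hμ S S' S'' hS hS' hS'' =>
    corrComp_surfaces_of_cup' hCUP μ hμ S S' S'' (IsK3Surface.isSmoothProjective hS)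
      (IsK3Surface.isSmoothProjective hS') (IsK3Surface.isSmoothProjective hS'')

/-- **The typed deliverable of the line** (composition r3): the three stubs, Buskin's theorem
(`HodgeIsometryAlgebraic`, route item stmt-HodgeConjecture-13675, the crux's declared dependency) and the
surjectivity of the period map (`K3PeriodSurjective`, route crux stmt-HodgeConjecture-15154) give
`Latt[M, N] ∧ TwinTransportFor[M]` for the lattice similitude `M` chosen by the count. Given a marked
projective `M`-twin pair with first period `x`, choose a polarisation `h` for which `x` is OFF-WALL
(`OffWallPolarisation`); the count for `h` is non-zero at an anchor `x₀` joined to `x` inside the off-wall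
locus (the heart); BKP's Thm 1.13 (`propagate`) makes `x` good; re-marking (Buskin, the landed
`PeriodInvariance`) makes the given pair good. No spreading over the Hodge locus and no topology of `D_h`
is needed any more (r1/r2's `TwinSpread`, `OffWallBall` are gone from the chain; the landed
`OffWallStable` / `PeriodDomainLocPathConnected` remain the tools for Stub 3 and for the informal
openness of the non-vanishing locus). -/
theorem twinTransport_of (h1 : NonzeroReducedClass) (h3 : OffWallPolarisation) (h5 : K3TransferFacts)
    (hB : HodgeIsometryAlgebraic) :
    ∃ (M N : Module.End ℂ (K3Index → ℂ)), Latt[M, N] ∧ TwinTransportFor[M] := by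
  obtain ⟨M, N, hlatt, hZ⟩ := h1
  obtain ⟨-, hCUP⟩ := h5
  have hcomp : CorrComp[] := corrComp_of_cupAlg hCUP
  refine ⟨M, N, hlatt, ?_⟩
  intro μ hμ S S' hS hS' η p x η' p' x' hm hx hm' hx' hper
  -- a polarisation for which the given period is off every wall
  obtain ⟨h, hhpos, hxD, hxW⟩ := h3 M N hlatt x hx
  -- the reduced count for `h`, non-zero at an anchor joined to `x` inside the off-wall locus
  obtain ⟨Z, x₀, hJ, hx₀⟩ := hZ μ hμ h hhpos x hxD hxW
  have hx₀L : x₀ ∈ OffWallLocus[M, h] := hJ.source_mem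
  -- BKP Thm 1.13 along the connected off-wall family through the anchor: `x` is good
  have hgood : GoodPairAt[M, μ, x] := Z.propagate x₀ hx₀L.1 x hxD hx₀L.2 hxW hJ hx₀
  -- re-marking (Buskin), the landed `stub_periodInvariance`
  exact periodInvariance_holds M N hlatt μ hμ hB Huybrechts_K3_hodgeTypes_H2_holds hcomp x hgood
    S S' hS hS' η p x η' p' x' hm hx hm' hx' hper ⟨1, (one_smul ℂ x).symm⟩

/-- **`TwinTwistorTransport_of` — the line's composition, concluding the route's typed crux
`Summit.HodgeConjecture.HodgeConjecture.Theses.NikulinTwinTransport.TwinTwistorTransport` BY NAME.**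
Hypotheses: the three stubs (heart, off-wall polarisation, named facts), Buskin's theorem
(`HodgeIsometryAlgebraic`, route item r2 = the crux's `[deps: HodgeIsometryAlgebraic]`) and the surjectivity
of the period map (`K3PeriodSurjective`, route crux r8, by name per the route's fact policy). The last step is
the tree's PROVED `twinTwistorTransport_of_twinTransport` (marking existence + Hodge types + period
surjectivity + `TwinTransportFor[M]` ⟹ crux, via `anchorAt_of_twinTransport` at `c = 2`);
`K3PeriodSurjective` is definitionally its first hypothesis (`IsK3Surface` unfolded). -/
theorem TwinTwistorTransport_of (h1 : NonzeroReducedClass) (h3 : OffWallPolarisation)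
    (h5 : K3TransferFacts) (hB : HodgeIsometryAlgebraic) (hP : K3PeriodSurjective) :
    TwinTwistorTransport := by
  obtain ⟨M, N, ⟨-, hNrat, hMN, hNM, hM2⟩, htw⟩ := twinTransport_of h1 h3 h5 hB
  exact twinTwistorTransport_of_twinTransport hP h5.1 Huybrechts_K3_hodgeTypes_H2_holds M N hNrat hMN
    hNM hM2 htw

/-- The typed deliverable with the registered stubs plugged in: modulo Buskin (`HodgeIsometryAlgebraic`)
the two open `stub_*` (heart + named facts) and the landed off-wall polarisation prove `Latt[M, N] ∧ TwinTransportFor[M]`. -/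
theorem twinTransport_of_line (hB : HodgeIsometryAlgebraic) :
    ∃ (M N : Module.End ℂ (K3Index → ℂ)), Latt[M, N] ∧ TwinTransportFor[M] :=
  twinTransport_of stub_nonzeroReducedClass offWallPolarisation_holds stub_k3TransferFacts hB

/-- The skeleton with the registered stubs plugged in: modulo Buskin (`HodgeIsometryAlgebraic`, route
item) and period surjectivity (`K3PeriodSurjective`, route crux) the two open `stub_*` (heart + named facts)
prove the crux `TwinTwistorTransport`. -/
theorem TwinTwistorTransport_of_line (hB : HodgeIsometryAlgebraic) (hP : K3PeriodSurjective) :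
    TwinTwistorTransport :=
  TwinTwistorTransport_of stub_nonzeroReducedClass offWallPolarisation_holds stub_k3TransferFacts hB hP

/-! ## Tightness of the posited interface (lead, cycle 1): the heart is crux-equivalent, with no slack

The interface `TwinSurfaceCount` posits nothing beyond its one axiom, so the research stub
`NonzeroReducedClass` cannot be cheaper than the crux: conversely to `TwinTwistorTransport_of`, twin
transport for ONE rational `2`-similitude `M` (in particular the crux itself, via the landed
`ratTwinTransport_of_twinTwistorTransport`, modulo Buskin, the composition of correspondences and the
K3 facts) yields a DEGENERATE instance — counted class `lagrangianType`, `nonzero := univ`,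
`propagate :=` the transport — as soon as every `D_h` contains an off-wall point (`OffWallPointsExist`,
known: a very general point of `D_h` is off every wall). These theorems are kernel-checked honesty
bookkeeping for the disprover and the consult: a `TwinSurfaceCount` with an off-wall point in its
locus EXISTS iff the crux holds (modulo the named facts); the BKP content lives entirely in HOW Stub 1
is to be proved (a non-zero reduced class at one anchor), not in its typed statement. -/

/-! ### Off-wall points exist in every polarised period domain -/

/-- **Off-wall points exist**: every `D_h` (`h² > 0`) contains a point off every wall of the
`h`-polarised `M`-twin family, for every rational lattice `2`-similitude `(M, N)`. Construction
(Huybrechts Ch. 7 §3.1 genericity trick, inside `h^⊥`): `a := n + ε g_h` with `n ⊥ h` positive,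
`g_h` the projection to `h^⊥` of a vector `g` with `g^⊥ ∩ Λ = 0` (`exists_k3_genericVector`) and
`ε` outside a countable set and small; then no non-zero lattice vector orthogonal to `h` is orthogonal
to `a`, and `(a.a) > 0`; complete by `b ⊥ a, h` with `(b.b) = (a.a)` inside a positive three-space;
`x₀ := a + ib ∈ D_h`. A root `δ ⊥ h, x₀` would be `0`; for a root `δ′` with `Mδ′ ⊥ h, x₀`, the
lattice vector `d·Mδ′` (`d` a common denominator of `M`) would be `0`, so `δ′ = N M δ′ = 0`.
[cite: Huybrechts2016K3, Ch. 7 §3.1 and Ch. 6 Rem. 1.6] -/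
theorem exists_offWall_mem_polarisedPeriodDomain :
    ∀ (M N : Module.End ℂ (K3Index → ℂ)), Latt[M, N] →
      ∀ (h : K3Index → ℤ), 0 < ∑ i, ∑ j, h i * k3Gram i j * h j →
        ∃ x₀ ∈ polarisedPeriodDomain h, OffWall[M, h, x₀] := by
  classical
  intro M N hlatt h hh
  obtain ⟨hMrat, -, -, hNM, -⟩ := hlatt
  set B : LinearMap.BilinForm ℝ (K3Index → ℝ) := Matrix.toBilin' (k3Gram.map (Int.cast : ℤ → ℝ))
    with hB
  have hBs : ∀ u w, B u w = B w u := k3RForm_comm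
  set hr : K3Index → ℝ := fun i => (h i : ℝ) with hhr
  have hhr_pos : 0 < B hr hr := by
    rw [hhr, k3RForm_intCast]; exact_mod_cast hh
  -- a positive triple, a positive `n ⊥ h`, a generic vector projected to `h^⊥`
  obtain ⟨t, ht, -⟩ := exists_k3_generic_posFamily hB
  obtain ⟨n, -, hnh, -, hn⟩ := twistorChain_exists_orthogonal_mem_span B t ht hr hr
  obtain ⟨g, hg⟩ := exists_k3_genericVector
  set gh : K3Index → ℝ := g - (B g hr / B hr hr) • hr with hgh
  have hgh_h : B gh hr = 0 := by
    rw [hgh, LinearMap.BilinForm.sub_left, LinearMap.BilinForm.smul_left,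
      div_mul_cancel₀ _ hhr_pos.ne', sub_self]
  have hgh_gen : ∀ v : K3Index → ℤ, B (fun i => (v i : ℝ)) hr = 0 →
      B (fun i => (v i : ℝ)) gh = 0 → v = 0 := by
    intro v hvh hvg
    apply hg v
    rw [hgh, LinearMap.BilinForm.sub_right, LinearMap.BilinForm.smul_right, hvh,
      mul_zero, sub_zero] at hvg
    exact hvg
  -- the admissible `ε`: small, and outside the countable bad set
  set K : ℝ := 2 * |B n gh| + |B gh gh| + 1 with hK
  have hK0 : 0 < K := by positivity
  have hδ0 : 0 < min 1 (B n n / K) := lt_min one_pos (div_pos hn hK0)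
  set C : Set ℝ := Set.range fun v : K3Index → ℤ =>
      -B (fun i => (v i : ℝ)) n / B (fun i => (v i : ℝ)) gh with hC
  have hCc : C.Countable := Set.countable_range _
  obtain ⟨ε, ⟨hε0, hεδ⟩, hεC⟩ := exists_mem_Ioo_notMem_of_countable hCc hδ0
  set a : K3Index → ℝ := n + ε • gh with ha
  have hah : B a hr = 0 := by
    rw [ha, LinearMap.BilinForm.add_left, LinearMap.BilinForm.smul_left, hnh, hgh_h,
      mul_zero, add_zero]
  have ha_gen : ∀ v : K3Index → ℤ, B (fun i => (v i : ℝ)) hr = 0 →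
      B (fun i => (v i : ℝ)) a = 0 → v = 0 := by
    intro v hvh hva
    by_contra hv0
    have hvg : B (fun i => (v i : ℝ)) gh ≠ 0 := fun h0 => hv0 (hgh_gen v hvh h0)
    rw [ha, LinearMap.BilinForm.add_right, LinearMap.BilinForm.smul_right] at hva
    exact hεC ⟨v, by rw [div_eq_iff hvg]; linarith⟩
  have ha_pos : 0 < B a a := by
    have hε1 : ε ≤ 1 := hεδ.le.trans (min_le_left _ _)
    have hεK : ε * K < B n n := by
      have : ε < B n n / K := hεδ.trans_le (min_le_right _ _)
      rwa [lt_div_iff₀ hK0] at this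
    have hexp : B a a = B n n + 2 * ε * B n gh + ε * ε * B gh gh := by
      rw [ha, LinearMap.BilinForm.add_left, LinearMap.BilinForm.add_right,
        LinearMap.BilinForm.add_right, LinearMap.BilinForm.smul_left, LinearMap.BilinForm.smul_left,
        LinearMap.BilinForm.smul_right, LinearMap.BilinForm.smul_right, hBs gh n]
      ring
    rw [hexp]
    have hεε : ε * ε ≤ ε := by nlinarith
    have hQ1 : -(ε * |B n gh|) ≤ ε * B n gh := by
      have := mul_le_mul_of_nonneg_left (neg_abs_le (B n gh)) hε0.le
      linarith
    have hR1 : -(ε * ε * |B gh gh|) ≤ ε * ε * B gh gh := by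
      have := mul_le_mul_of_nonneg_left (neg_abs_le (B gh gh)) (mul_self_nonneg ε)
      linarith
    have hR2 : ε * ε * |B gh gh| ≤ ε * |B gh gh| :=
      mul_le_mul_of_nonneg_right hεε (abs_nonneg _)
    have hexpK : ε * K = 2 * (ε * |B n gh|) + ε * |B gh gh| + ε := by rw [hK]; ring
    linarith
  -- complete `a` to a conformal orthogonal pair inside `h^⊥`
  obtain ⟨m, -, hmh, hma, hm⟩ := twistorChain_exists_orthogonal_mem_span B t ht hr a
  set s : ℝ := Real.sqrt (B a a / B m m) with hs
  set b : K3Index → ℝ := s • m with hb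
  have hab : B a b = 0 := by
    rw [hb, LinearMap.BilinForm.smul_right, hBs a m, hma, mul_zero]
  have hbb : B a a = B b b := by
    rw [hb, LinearMap.BilinForm.smul_left, LinearMap.BilinForm.smul_right,
      ← mul_assoc, Real.mul_self_sqrt (div_nonneg ha_pos.le hm.le), div_mul_cancel₀ _ hm.ne']
  have hha : B hr a = 0 := by rw [hBs, hah]
  have hhb : B hr b = 0 := by
    rw [hb, LinearMap.BilinForm.smul_right, hBs hr m, hmh, mul_zero]
  set x₀ : K3Index → ℂ := fun i => (a i : ℂ) + (b i : ℂ) * Complex.I with hx₀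
  have hx₀D : x₀ ∈ polarisedPeriodDomain h := polarisedPeriod_mk_mem hB hab hbb ha_pos hha hhb
  have hre : (fun j => (x₀ j).re) = a := by funext j; simp [hx₀]
  -- genericity of `x₀` against lattice vectors orthogonal to `h`
  have hx_gen : ∀ v : K3Index → ℤ, B (fun i => (v i : ℝ)) hr = 0 →
      k3Form (fun i => (v i : ℂ)) x₀ = 0 → v = 0 := by
    intro v hvh hvx
    have hvC : (fun i => (v i : ℂ)) = fun i => (((v i : ℝ) : ℝ) : ℂ) := by funext i; simp
    rw [hvC] at hvx
    obtain ⟨hva, -⟩ := k3Real_orthogonal_re_im hvx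
    rw [hre, ← hB] at hva
    exact ha_gen v hvh hva
  refine ⟨x₀, hx₀D, ?_, ?_⟩
  · -- first wall family: integral roots orthogonal to `h`
    intro δ hδ hδh hδx
    have hδhr : B (fun i => (δ i : ℝ)) hr = 0 := by
      rw [hhr, k3RForm_intCast, hδh, Int.cast_zero]
    have hδ0 : δ = 0 := hx_gen δ hδhr hδx
    rw [hδ0] at hδ
    simp at hδ
  · -- second wall family: `Mδ′` with `δ′` a root
    intro δ hδ hMh hMx
    obtain ⟨d, hd0, hd⟩ := twinLatt_exists_common_denominator M hMrat
    obtain ⟨mv, hmv⟩ := hd δ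
    have hdR : (d : ℝ) ≠ 0 := by exact_mod_cast hd0
    -- `M δ = (1/d) · mv`, `mv` integral
    have hscale : (fun i => ((((mv i : ℝ) / (d : ℝ) : ℝ)) : ℂ)) =
        ((1 / (d : ℝ) : ℝ) : ℂ) • fun i => ((mv i : ℤ) : ℂ) := by
      funext i
      simp only [Pi.smul_apply, smul_eq_mul]
      push_cast
      ring
    rw [hmv, hscale, k3Form_smul_left, mul_eq_zero] at hMh hMx
    have hc0 : (((1 / (d : ℝ) : ℝ)) : ℂ) ≠ 0 := by
      exact_mod_cast one_div_ne_zero hdR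
    have hMh' := hMh.resolve_left hc0
    have hMx' := hMx.resolve_left hc0
    have hmvh : B (fun i => (mv i : ℝ)) hr = 0 := by
      have hhC : (fun i => (h i : ℂ)) = fun i => (((h i : ℝ) : ℝ) : ℂ) := by funext i; simp
      have hmC : (fun i => ((mv i : ℤ) : ℂ)) = fun i => (((mv i : ℝ) : ℝ) : ℂ) := by funext i; simp
      rw [hhC, hmC, k3Form_ofReal_eq_k3RForm] at hMh'
      rw [hhr]
      exact_mod_cast hMh'
    have hmv0 : mv = 0 := hx_gen mv hmvh hMx'
    have hMδ0 : M (fun i => (δ i : ℂ)) = 0 := by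
      rw [hmv]; funext i; simp [hmv0]
    have hδC0 : (fun i => (δ i : ℂ)) = 0 := by
      have := congrArg N hMδ0
      rwa [← Module.End.mul_apply, hNM, Module.End.one_apply, map_zero] at this
    have hδ0 : δ = 0 := by
      funext i
      have := congrFun hδC0 i
      simp only [Pi.zero_apply, Int.cast_eq_zero] at this
      exact this
    rw [hδ0] at hδ
    simp at hδ

/-! ### Twin transport gives a good pair at every polarised period -/

/-- A rational `2`-similitude `M` with two-sided inverse `N` makes `N` a `½`-similitude:
`(Na.Nb) = ½ (a.b)`. [folklore] -/
theorem k3Form_inv_of_latt {M N : Module.End ℂ (K3Index → ℂ)} (hMN : M * N = 1)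
    (hM2 : ∀ a b, k3Form (M a) (M b) = 2 * k3Form a b) (a b : K3Index → ℂ) :
    k3Form (N a) (N b) = ((1 / 2 : ℚ) : ℂ) * k3Form a b := by
  have h := hM2 (N a) (N b)
  rw [← Module.End.mul_apply, ← Module.End.mul_apply, hMN, Module.End.one_apply,
    Module.End.one_apply] at h
  rw [h]
  push_cast
  ring

/-- **Twin transport gives goodness at every polarised period.** Granted the surjectivity of the
period map (`K3PeriodSurjective`, route crux), for a rational lattice `2`-similitude `(M, N)` with
`TwinTransportFor[M]`, every `x ∈ D_h` (`h² > 0`) carries a good marked `M`-twin pair: realise `x` by a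
marked projective K3 surface (period surjectivity; `PeriodPt[x]` from `h`), realise the twin period
`N x` likewise (`periodPt_simil`: `N` is a rational `½`-similitude), note `M (N x) = x`, and apply the
transport. [cite: Huybrechts2016K3, Ch. 6 Thm. 3.1 / Rem. 3.3 and Ch. 7 Thm. 4.1] -/
theorem goodPairAt_of_twinTransport :
    K3PeriodSurjective → ∀ (M N : Module.End ℂ (K3Index → ℂ)), Latt[M, N] → TwinTransportFor[M] →
      ∀ (μ : OrientationFamily), μ.HasPoincareDuality →
        ∀ (h : K3Index → ℤ), 0 < ∑ i, ∑ j, h i * k3Gram i j * h j →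
          ∀ x ∈ polarisedPeriodDomain h, GoodPairAt[M, μ, x] := by
  intro hP M N hlatt htw μ hμ h hh x hx
  obtain ⟨-, hNrat, hMN, -, hM2⟩ := hlatt
  have hxP : PeriodPt[x] := periodPt_of_mem_polarisedPeriodDomain hh hx
  have hNxP : PeriodPt[N x] :=
    periodPt_simil N hNrat (1 / 2) (by norm_num) (k3Form_inv_of_latt hMN hM2) hxP
  obtain ⟨S, hS, η, p, hm⟩ := hP x hxP.1 hxP.2.1 hxP.2.2
  obtain ⟨S', hS', η', p', hm'⟩ := hP (N x) hNxP.1 hNxP.2.1 hNxP.2.2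
  have hper : ∃ t : ℂ, M (N x) = t • x :=
    ⟨1, by rw [← Module.End.mul_apply, hMN, Module.End.one_apply, one_smul]⟩
  obtain ⟨γ, hγ, hγeq⟩ := htw μ hμ S S' hS hS' η p x η' p' (N x) hm hxP hm' hNxP hper
  exact ⟨S, S', hS, hS', η, p, η', p', N x, hm, hxP, hm', hNxP, hper, γ, hγ, hγeq⟩


/-- `OffWallPointsExist`: for every rational lattice `2`-similitude `(M, N)` and every `h` with
`h² > 0`, the polarised period domain `D_h` contains an OFF-WALL point. Why true: `D_h ≠ ∅`
(`h^⊥_ℝ` has signature `(2, 19)`), and a very general `x ∈ D_h` (`x^⊥ ∩ Λ_ℚ = ℚh`) is off every wall: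
a root `δ ⊥ h` with `δ ⊥ x` would lie in `ℚh`, and `Mδ′ ⊥ x` forces `Mδ′ ∈ ℚh`, contradicting
`Mδ′ ⊥ h`, `Mδ′ ≠ 0`. Size M (Liouville-vector genericity as in `K3TwistorLines.exists_k3_genericVector`
plus a perturbation inside `h^⊥`). Consumed only by the tightness theorems below, never by the
composition. [cite: Huybrechts2016K3, Ch. 6 §1.1 and Rem. 1.6] -/
def OffWallPointsExist : Prop :=
  ∀ (M N : Module.End ℂ (K3Index → ℂ)), Latt[M, N] →
    ∀ (h : K3Index → ℤ), 0 < ∑ i, ∑ j, h i * k3Gram i j * h j →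
      ∃ x₀ ∈ polarisedPeriodDomain h, OffWall[M, h, x₀]

/-- **`OffWallPointsExist` holds** — LANDED as
`Theorems.NikulinTwinTransport.exists_offWall_mem_polarisedPeriodDomain` (p106664, lead, cycle 1):
every `D_h` (`h² > 0`) contains a point off every wall of the `h`-polarised `M`-twin family, for
every rational lattice `2`-similitude `(M, N)` (genericity trick of Huybrechts Ch. 7 §3.1 run inside
`h^⊥`; a wall vector through the generic point would vanish). [cite: Huybrechts2016K3, Ch. 7 §3.1 and Ch. 6 Rem. 1.6] -/
theorem offWallPointsExist_holds : OffWallPointsExist := exists_offWall_mem_polarisedPeriodDomain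

/-! `goodPairAt_of_twinTransport` (twin transport + period surjectivity give a good marked `M`-twin
pair at every polarised period) is LANDED in the same module (p106664) and used below by name. -/

/-- **Tightness, transport form.** Twin transport for one rational lattice `2`-similitude with
rational inverse yields an instance of Stub 1 (`NonzeroReducedClass`), granted period surjectivity (off-wall
points exist by `offWallPointsExist_holds`): the degenerate count `⟨lagrangianType, univ, transport⟩`. So the
typed heart of the line is implied by (hence, with `TwinTwistorTransport_of`, equivalent to) the
lattice-level crux `∃ M N, Latt[M, N] ∧ TwinTransportFor[M]` modulo known facts. [folklore] -/
theorem nonzeroReducedClass_of_twinTransport (hP : K3PeriodSurjective)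
    (htw : ∃ (M N : Module.End ℂ (K3Index → ℂ)), Latt[M, N] ∧ TwinTransportFor[M]) :
    NonzeroReducedClass := by
  obtain ⟨M, N, hlatt, htw⟩ := htw
  refine ⟨M, N, hlatt, fun μ hμ h hh x hxD hxW => ?_⟩
  exact ⟨⟨AdmissibleClass.lagrangianType, Set.univ,
      fun _ _ y hy _ _ _ _ => goodPairAt_of_twinTransport hP M N hlatt htw μ hμ h hh y hy⟩,
    x, JoinedIn.refl ⟨hxD, hxW⟩, Set.mem_univ _⟩

/-- **Tightness, crux form.** The crux `TwinTwistorTransport` itself yields an instance of Stub 1,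
granted Buskin's theorem (`HodgeIsometryAlgebraic`), the multiplicativity of algebraic classes on
triple products of surfaces (`cupProduct_mem_algebraicClasses_tripleProduct_surfaces`, giving the
composition of correspondences by `corrComp_surfaces_of_cup'`) and period surjectivity: by the landed `ratTwinTransport_of_twinTwistorTransport` the crux gives
`TwinTransportFor[M]` for the integral `2`-similitude of `exists_twoSimilitude_k3Lattice`. Together
with `TwinTwistorTransport_of`: modulo these known facts and `OffWallPolarisation`, Stub 1 ⟺ crux — the
interface adds no slack and no strength. [cite: Buskin2019, Thm. 1.1 and §6.2] -/
theorem nonzeroReducedClass_of_crux (hB : HodgeIsometryAlgebraic)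
    (hCUP : cupProduct_mem_algebraicClasses_tripleProduct_surfaces) (hP : K3PeriodSurjective)
    (hcrux : TwinTwistorTransport) : NonzeroReducedClass := by
  have hrat := ratTwinTransport_of_twinTwistorTransport hB (corrComp_surfaces_of_cup' hCUP)
    Huybrechts_K3_hodgeTypes_H2_holds hcrux
  obtain ⟨M, N, hMrat, hNrat, hMN, hNM, hM2⟩ := exists_twoSimilitude_k3Lattice
  exact nonzeroReducedClass_of_twinTransport hP
    ⟨M, N, ⟨hMrat, hNrat, hMN, hNM, hM2⟩, hrat M N hMrat hNrat hMN hNM hM2⟩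

/-- **The line's exact position, kernel-checked** (lead, cycle 1): modulo the route items
`HodgeIsometryAlgebraic` (Buskin) and `K3PeriodSurjective`, the two named Literature facts of
`K3TransferFacts` and the lattice stub `OffWallPolarisation`, the research stub `NonzeroReducedClass` is
EQUIVALENT to the crux `TwinTwistorTransport`. -/
theorem nonzeroReducedClass_iff_crux (hB : HodgeIsometryAlgebraic) (hP : K3PeriodSurjective)
    (h3 : OffWallPolarisation) (h5 : K3TransferFacts) : NonzeroReducedClass ↔ TwinTwistorTransport :=
  ⟨fun h1 => TwinTwistorTransport_of h1 h3 h5 hB hP, nonzeroReducedClass_of_crux hB h5.2 hP⟩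

/-- **Anti-vacuity of the heart's hypotheses**: the antecedent "`x ∈ D_h` off-wall" of the r3 heart is met
for every `h² > 0` (`offWallPointsExist_holds`, landed as `exists_offWall_mem_polarisedPeriodDomain`), so the
component-wise heart is not vacuously true. -/
theorem nonzeroReducedClass_hypotheses_nonvacuous {M N : Module.End ℂ (K3Index → ℂ)} (hlatt : Latt[M, N])
    {h : K3Index → ℤ} (hh : 0 < ∑ i, ∑ j, h i * k3Gram i j * h j) :
    ∃ x ∈ polarisedPeriodDomain h, OffWall[M, h, x] :=
  offWallPointsExist_holds M N hlatt h hh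

end Summit.HodgeConjecture.HodgeConjecture.Cruxes.TwinTwistorTransport.ReducedVirtualCountTwinLocus

end
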